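import Summits.HodgeConjecture.HodgeConjecture.Theorems.LinearSystemTorelliLocalTubeSpanThinDynamicsLemmas

/-!
# Route LinearSystemTorelli — crux `LocalTubeSpan`: the thin family `μ ≥ 4` — lemmas for the ping-pong dynamics

Helper file (`--supports stmt-HodgeConjecture-2490`, line `Sketch`, cycle 4 wave 3; the `μ`-parametric
companions of `LinearSystemTorelliLocalTubeSpanThinDynamicsLemmas` (`μ = 4`), consumed by
`LinearSystemTorelliLocalTubeSpanThinDynamicsMu` = stub `stub_thinDynamicsMu`, taken by the line
lead).  On `V = ℚ²` with `B₀(x, y) = μ(x₀y₁ - x₁y₀)` the transvections along `(1,0)`, `(0,1)`,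
`(1,1)` are `T₁(v) = (v₀ + μv₁, v₁)`, `T₂(v) = (v₀, v₁ - μv₀)`, `T₃(v) = v - μ(v₀ - v₁)(1,1)`; for
EVERY `μ ≥ 4` they play ping-pong on the cones `C₁ = {2|v₁| ≤ |v₀|}`, `C₂ = {2|v₀| ≤ |v₁|}`,
`C₃ = {μ|v₀ - v₁| ≤ |v₀ + v₁|}`.

Contents: `…_thinConesMu_disjoint₀₂/₁₂` (the third cone meets the first two in `0`, for `μ ≥ 4`;
`C₁ ∩ C₂ = 0` is the `μ`-free `…_thinCones_disjoint₀₁`), `…_thinMu_transvectionData`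
(`ρ((τ i)^n) v = v - n ℓ_i(v) d_i` with `ℓ = (-μv₁, μv₀, μ(v₀ - v₁))`), `…_thinMu_det_eq_one`.
No named facts; pure linear algebra over `ℚ`.

References: [Schnell2010] C. Schnell, Primitive cohomology and the tube mapping, Math. Z. 268
(2010) §7; the ping-pong lemma (folklore, Lyndon–Schupp III.12).
-/

-- `Summit.HodgeConjecture.HodgeConjecture.Theorems` is the mandated namespace (single-conjunct summit:
-- Sub = Summit), which `linter.dupNamespace` flags on every declaration; the lakefile turns the
-- linter off tree-wide (weak option), restated here so stand-alone elaboration is warning-free too.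
set_option linter.dupNamespace false

noncomputable section

open Matrix

namespace Summit.HodgeConjecture.HodgeConjecture.Theorems

/-! ### The third cone against the first two, for `μ ≥ 4` -/

/-- Cones `C₁ = {2|w₁| ≤ |w₀|}` and `C₃ = {μ|w₀ - w₁| ≤ |w₀ + w₁|}` meet only in `0` when `μ ≥ 4`
(`|w₀ + w₁| ≤ 3|w₀|/2 < 2|w₀| ≤ μ|w₀ - w₁|` off `0`). [folklore] -/
theorem localTubeSpan_thinConesMu_disjoint₀₂ (μ : ℚ) (hμ : 4 ≤ μ) (w : Fin 2 → ℚ)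
    (h0 : |2| * |w 1| ≤ |w 0|) (h2 : |μ| * |w 0 - w 1| ≤ |w 0 + w 1|) : w = 0 := by
  rw [abs_two] at h0
  rw [abs_of_nonneg (by linarith : (0 : ℚ) ≤ μ)] at h2
  have t1 := abs_sub_abs_le_abs_sub (w 0) (w 1)
  have t2 := abs_add_le (w 0) (w 1)
  have h4 : 4 * |w 0 - w 1| ≤ μ * |w 0 - w 1| := mul_le_mul_of_nonneg_right hμ (abs_nonneg _)
  have e0 : |w 0| ≤ 0 := by linarith [abs_nonneg (w 0), abs_nonneg (w 1)]
  have e1 : |w 1| ≤ 0 := by linarith [abs_nonneg (w 0), abs_nonneg (w 1)]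
  ext j; fin_cases j
  · exact abs_nonpos_iff.1 e0
  · exact abs_nonpos_iff.1 e1

/-- Cones `C₂ = {2|w₀| ≤ |w₁|}` and `C₃ = {μ|w₀ - w₁| ≤ |w₀ + w₁|}` meet only in `0` when `μ ≥ 4`.
[folklore] -/
theorem localTubeSpan_thinConesMu_disjoint₁₂ (μ : ℚ) (hμ : 4 ≤ μ) (w : Fin 2 → ℚ)
    (h1 : |2| * |w 0| ≤ |w 1|) (h2 : |μ| * |w 0 - w 1| ≤ |w 0 + w 1|) : w = 0 := by
  rw [abs_two] at h1
  rw [abs_of_nonneg (by linarith : (0 : ℚ) ≤ μ)] at h2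
  have t1 := abs_sub_abs_le_abs_sub (w 1) (w 0)
  have t1' : |w 1 - w 0| = |w 0 - w 1| := abs_sub_comm _ _
  have t2 := abs_add_le (w 0) (w 1)
  have h4 : 4 * |w 0 - w 1| ≤ μ * |w 0 - w 1| := mul_le_mul_of_nonneg_right hμ (abs_nonneg _)
  have e1 : |w 1| ≤ 0 := by linarith [abs_nonneg (w 0), abs_nonneg (w 1)]
  have e0 : |w 0| ≤ 0 := by linarith [abs_nonneg (w 0), abs_nonneg (w 1)]
  ext j; fin_cases j
  · exact abs_nonpos_iff.1 e0
  · exact abs_nonpos_iff.1 e1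

/-! ### The transvection data and determinant one, parameter `μ` -/

/-- **Integer powers of the three transvections** (parameter `μ`).  For a group acting on `ℚ²` with
`τ 0, τ 1, τ 2` acting as `T₁, T₂, T₃`: functionals `ℓ_i = (-μv₁, μv₀, μ(v₀ - v₁))` and cycles
`d_i = ((1,0), (0,1), (1,1))` with `ρ((τ i)^n) v = v - n ℓ_i(v) d_i` for every integer `n`.
[folklore] -/
theorem localTubeSpan_thinMu_transvectionData (μ : ℚ) {G : Type} [Group G]
    (ρ : Representation ℚ G (Fin 2 → ℚ)) (τ : Fin 3 → G)
    (hτ₀ : ∀ v, ρ (τ 0) v = ![v 0 + μ * v 1, v 1])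
    (hτ₁ : ∀ v, ρ (τ 1) v = ![v 0, v 1 - μ * v 0])
    (hτ₂ : ∀ v, ρ (τ 2) v = ![v 0 - μ * (v 0 - v 1), v 1 - μ * (v 0 - v 1)]) :
    ∃ (d : Fin 3 → (Fin 2 → ℚ)) (ℓ : Fin 3 → (Fin 2 → ℚ) →ₗ[ℚ] ℚ),
      d 0 = ![1, 0] ∧ d 1 = ![0, 1] ∧ d 2 = ![1, 1] ∧
      (∀ v, ℓ 0 v = -μ * v 1) ∧ (∀ v, ℓ 1 v = μ * v 0) ∧ (∀ v, ℓ 2 v = μ * (v 0 - v 1)) ∧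
      ∀ (i : Fin 3) (n : ℤ) (v : Fin 2 → ℚ), ρ (τ i ^ n) v = v - ((n : ℚ) * ℓ i v) • d i := by
  obtain ⟨d, hd0, hd1, hd2⟩ : ∃ d : Fin 3 → (Fin 2 → ℚ),
      d 0 = ![1, 0] ∧ d 1 = ![0, 1] ∧ d 2 = ![1, 1] := ⟨![![1, 0], ![0, 1], ![1, 1]], rfl, rfl, rfl⟩
  obtain ⟨ℓ, hℓ0, hℓ1, hℓ2⟩ : ∃ ℓ : Fin 3 → (Fin 2 → ℚ) →ₗ[ℚ] ℚ,
      (∀ v, ℓ 0 v = -μ * v 1) ∧ (∀ v, ℓ 1 v = μ * v 0) ∧ (∀ v, ℓ 2 v = μ * (v 0 - v 1)) := by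
    let π : Fin 2 → ((Fin 2 → ℚ) →ₗ[ℚ] ℚ) := fun j => LinearMap.proj j
    refine ⟨![(-μ) • π 1, μ • π 0, μ • (π 0 - π 1)],
      fun v => ?_, fun v => ?_, fun v => ?_⟩ <;> simp [π, mul_sub]
  have hℓd : ∀ i, ℓ i (d i) = 0 := by
    intro i
    match i with
    | 0 => simp [hℓ0, hd0]
    | 1 => simp [hℓ1, hd1]
    | 2 => simp [hℓ2, hd2]
  have hgen : ∀ i v, ρ (τ i) v = v - ℓ i v • d i := by
    intro i v
    match i with
    | 0 => rw [hτ₀, hℓ0, hd0]; ext j; fin_cases j <;> simp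
    | 1 => rw [hτ₁, hℓ1, hd1]; ext j; fin_cases j <;> simp
    | 2 => rw [hτ₂, hℓ2, hd2]; ext j; fin_cases j <;> simp
  have hinv : ∀ i v, ρ (τ i)⁻¹ v = v + ℓ i v • d i := by
    intro i v
    have h1 : ρ (τ i) (v + ℓ i v • d i) = v := by
      rw [hgen, map_add, map_smul, hℓd, smul_eq_mul, mul_zero, add_zero, add_sub_cancel_right]
    have h2 : ρ (τ i)⁻¹ (ρ (τ i) (v + ℓ i v • d i)) = v + ℓ i v • d i := by
      rw [← Module.End.mul_apply, ← map_mul, inv_mul_cancel, map_one, Module.End.one_apply]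
    rw [h1] at h2
    exact h2
  have hzpow : ∀ (i : Fin 3) (n : ℤ) (v : Fin 2 → ℚ),
      ρ (τ i ^ n) v = v - ((n : ℚ) * ℓ i v) • d i := by
    intro i n
    induction n using Int.induction_on with
    | zero => intro v; simp
    | succ k ih =>
      intro v
      rw [zpow_add_one, map_mul, Module.End.mul_apply, hgen, ih, map_sub, map_smul, hℓd,
        smul_eq_mul, mul_zero, sub_zero, sub_sub, ← add_smul]
      push_cast
      ring_nf
    | pred k ih =>
      intro v
      rw [zpow_sub_one, map_mul, Module.End.mul_apply, hinv, ih, map_add, map_smul, hℓd,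
        smul_eq_mul, mul_zero, add_zero]
      ext j
      simp only [Pi.add_apply, Pi.sub_apply, Pi.smul_apply, smul_eq_mul]
      push_cast
      ring
  exact ⟨d, ℓ, hd0, hd1, hd2, hℓ0, hℓ1, hℓ2, hzpow⟩

/-- **Determinant one** (parameter `μ`): every element of the group generated by `τ 0, τ 1, τ 2`
acts on `ℚ²` with determinant `1` (the generators act by `(1 μ; 0 1)`, `(1 0; -μ 1)`,
`(1-μ μ; -μ 1+μ)`). [folklore] -/
theorem localTubeSpan_thinMu_det_eq_one (μ : ℚ) {G : Type} [Group G]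
    (ρ : Representation ℚ G (Fin 2 → ℚ)) (τ : Fin 3 → G)
    (hτ₀ : ∀ v, ρ (τ 0) v = ![v 0 + μ * v 1, v 1])
    (hτ₁ : ∀ v, ρ (τ 1) v = ![v 0, v 1 - μ * v 0])
    (hτ₂ : ∀ v, ρ (τ 2) v = ![v 0 - μ * (v 0 - v 1), v 1 - μ * (v 0 - v 1)]) :
    ∀ g ∈ Subgroup.closure (Set.range τ), LinearMap.det (ρ g) = 1 := by
  have hdetgen : ∀ i, LinearMap.det (ρ (τ i)) = 1 := by
    intro i
    have hmat : ∀ (Mx : Matrix (Fin 2) (Fin 2) ℚ), (∀ v, ρ (τ i) v = Mx *ᵥ v) →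
        ρ (τ i) = Matrix.toLin' Mx := fun Mx h =>
      LinearMap.ext fun v => by rw [Matrix.toLin'_apply, h]
    match i with
    | 0 =>
      rw [hmat !![1, μ; 0, 1] (fun v => by
        rw [hτ₀]; ext j; fin_cases j <;> simp [Matrix.mulVec, dotProduct, Fin.sum_univ_two]),
        LinearMap.det_toLin', Matrix.det_fin_two_of]
      ring
    | 1 =>
      rw [hmat !![1, 0; -μ, 1] (fun v => by
        rw [hτ₁]; ext j; (fin_cases j <;> simp [Matrix.mulVec, dotProduct, Fin.sum_univ_two]);
          ring),
        LinearMap.det_toLin', Matrix.det_fin_two_of]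
      ring
    | 2 =>
      rw [hmat !![1 - μ, μ; -μ, 1 + μ] (fun v => by
        rw [hτ₂]; ext j; fin_cases j <;> simp [Matrix.mulVec, dotProduct, Fin.sum_univ_two]
          <;> ring),
        LinearMap.det_toLin', Matrix.det_fin_two_of]
      ring
  intro g hg
  induction hg using Subgroup.closure_induction with
  | mem g hg => obtain ⟨i, rfl⟩ := hg; exact hdetgen i
  | one => rw [map_one, map_one]
  | mul g h _ _ ihg ihh => rw [map_mul, map_mul, ihg, ihh, mul_one]
  | inv g _ ih =>
    have : LinearMap.det (ρ g⁻¹) * LinearMap.det (ρ g) = 1 := by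
      rw [← map_mul, ← map_mul, inv_mul_cancel, map_one, map_one]
    rwa [ih, mul_one] at this

end Summit.HodgeConjecture.HodgeConjecture.Theorems

end
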